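import Summits.QuantumFields.BalabanUV.Beta.RemainderExplicitHistoryDiagonalWindow

/-!
# RemainderExplicitHistoryDiagonalWindowSource — ROAD P3, ORDER-0 PROFILE FAMILY: THE WINDOW SOURCE PRICED BY THE MISSING AGES, AND THE
# POSITION-RESOLVED TWO-SIDED LAW MODULO THE ULTRAVIOLET FEEDBACK — for two infrared-pinned runs (A: `K` steps, B: `K + n` steps) the window
# source of `…Window.window_identity` is `≍ 𝒯 := Σ_{j∈[j₀,K)} (R(j+n+1) − R(j+1))∕√(K−j)` (`R(k) = Σ_{a<k} ρ(a)`: at window position `j` the ages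
# `[j+1, j+n]` are B's and not A's; from above by the coupling ceiling `1∕√(b(K−j))`, from below — infrared half — by generation 48's
# `profile_min_le_gap`, every missing age there exceeding the infrared distance), hence in the infrared half `2j₀ + 1 ≥ K`:
# `𝒯∕(8κ₂√b₂) ≤ d_{j₀} + (Wγ∕b)·max_{[j₀,K]} d` (NO smallness) and `d_{j₀} ≤ 𝒯∕√b + Σ_{i<j₀} ((g^A_i)³∕2)·d_i·(R(K−i) − R(j₀−i))`
# (second file of station S-d4p3-g49-1 «the rate in the cutoff»)

Cell `pub-balaban`, β-function sub-cell, BINDER row D4 «RemainderConst leaves for Bałaban's split» (`HOME/BINDER-OWNERS.md`; owner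
lineage `b2b-balaban-beta-an4`; this file by co-owner #3 lineage `b2b-balaban-beta-d4-p3`, road P3 «the reduction road», generation 49,
station S-d4p3-g49-1, second file; imports the station's first file `RemainderExplicitHistoryDiagonalWindow` (hence generation 48's
`…Source`, `…TwoRun`, `…Weights`)), β-FLOW TEAM duty (1); FREEZE (0) honoured (def-free module in road P3's own `RemainderExplicit*` series; no
leaf, no interface, no Literature file).  SOURCE OF THE SHAPES ONLY: [Balaban1987RG1] (0.20) p. 256, (0.31) and Thm 2 p. 259, §5 p. 298.  Pure
real analysis about ONE explicit toy family (ours).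

HONEST FRAMING (page 1 of everything the β sub-cell writes).  *"Discharging BetaPertH makes Bałaban's UV stability UNCONDITIONAL — a real
constructive-QFT result; it is NOT the continuum limit and NOT the Clay problem."*  THIS FILE DISCHARGES NOTHING OF THE KIND.  The first file
wrote the matched discrepancy `d_{j₀} = 1∕(g^B_{j₀+n})² − 1∕(g^A_{j₀})²` at one position EXACTLY as «window source» + «ultraviolet feedback» +
«window damping».  Here (§1) the window source is priced position by position by the MISSING AGES: at window position `j` (infrared distance
`K − j`) the longer run's β carries the extra ages `a ∈ [j+1, j+n]`, each with the coupling gap `g^B_{j+n} − g^B_{j+n−a}`, which is at most the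
coupling `≤ 1∕√(b(K−j))` and — when `a ≥ K − j`, automatic in the infrared half — at least `1∕(8κ₂√(b₂(K−j)))` (`b₂ = 1∕(g^B_{K+n})² + b + Wγ`,
`κ₂ = b₂∕b`, generation 48's floor-and-ceiling currency).  So the source is `≍ 𝒯 = Σ_{j∈[j₀,K)} (R(j+n+1) − R(j+1))∕√(K−j)`: the window's missing
ages over the root of the infrared distance; as `n → ∞` the inner sums become the TAILS `Σ_{a>j} ρ(a)` of the profile — the currency of a RATE
in the cutoff (§2 assembles both sides; the third file resolves the ultraviolet feedback).  Nothing of Bałaban's (1.22) is asserted or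
constructed; row D4 class UNCHANGED (critical-path width 0; instance 0∕1; D4 DISCHARGE NO DATE); NOT B12 Thm 2, NOT BetaPertH, NOT continuum,
NOT Clay.  HONEST DEPENDENCY: continuum YM on T⁴ ⇐ BetaPertH ∧ nine spine estimates (0/9 proved); BetaPertH ⇐ (D1) ∧ (D4) ∧ CAP+tail; G-an2-4
gates asym, D1 and NE2/3/4.  ABSOLUTE RULE: nothing is cited as a fact.

WHAT IS PROVED ([folklore]; 0 sorry; 0 `def`; hypotheses as in the first file; `R(k) := Σ_{a<k} ρ(a)` written out as a `range` sum).
* §1 `sum_extra_eq_window` (`Σ_{i<n} ρ(j+n−i) = R(j+n+1) − R(j+1)`), **`extra_le_tail`** (`E_j ≤ (R(j+n+1) − R(j+1))∕√(b(K−j))`), **`tail_le_extra`**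
  (`2j+1 ≥ K` ⇒ `(R(j+n+1) − R(j+1))∕(8κ₂√(b₂(K−j))) ≤ E_j`), `sum_extra_le_tailWindow` (`Σ_{[j₀,K)} E ≤ 𝒯∕√b`), `tailWindow_le_sum_extra`
  (`2j₀+1 ≥ K` ⇒ `𝒯∕(8κ₂√b₂) ≤ Σ_{[j₀,K)} E`).
* §2 **`window_law_upper`** (`2j₀+1 ≥ K` ⇒ `d_{j₀} ≤ 𝒯∕√b + Σ_{i<j₀} ((g^A_i)³∕2)·d_i·(R(K−i) − R(j₀−i))`) and **`window_law_lower`**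
  (`2j₀+1 ≥ K` ⇒ `𝒯∕(8κ₂√b₂) ≤ d_{j₀} + (Wγ∕b)·P` for any bound `P` of `d` on `[j₀,K]`, hence `∃ j ∈ [j₀,K], 𝒯 ≤ 8κ₂√b₂(1 + Wγ∕b)·d_j`).
All letters NOT-IN-PRINT; `BetaFlowAsPrinted S` records a Markov β_n only ⇒ no junction of the as-printed interface changes.
-/

noncomputable section

open Finset Filter Topology

namespace Summit.QuantumFields.BalabanUV.Beta.RemainderExplicitHistoryDiagonalWindowSource

open Literature.MathematicalPhysics.QuantumFieldTheory.Balaban1983to89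
open Literature.MathematicalPhysics.QuantumFieldTheory.Balaban1983to89.FlowStep
open Literature.MathematicalPhysics.QuantumFieldTheory.Balaban1983to89.T4CouplingMatching
open Summit.QuantumFields.BalabanUV.Beta.RemainderExplicitHistoryDiagonalMonotone
open Summit.QuantumFields.BalabanUV.Beta.RemainderExplicitHistoryDiagonalWeights
open Summit.QuantumFields.BalabanUV.Beta.RemainderExplicitHistoryDiagonalTwoRun
open Summit.QuantumFields.BalabanUV.Beta.RemainderExplicitHistoryDiagonalSource
open Summit.QuantumFields.BalabanUV.Beta.RemainderExplicitHistoryDiagonalWindow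

variable {β : HBeta} {b γ W : ℝ} {ρ : ℕ → ℝ}

/-! ## §1 The window source priced by the missing ages of each position -/

/-- The extra ages at position `j` are `[j+1, j+n]`: `Σ_{i<n} ρ(j+n−i) = R(j+n+1) − R(j+1)`. [folklore] -/
theorem sum_extra_eq_window (ρ : ℕ → ℝ) (j n : ℕ) :
    ∑ i ∈ range n, ρ (j + n - i) = ∑ a ∈ range (j + n + 1), ρ a - ∑ a ∈ range (j + 1), ρ a := by
  rw [← Finset.sum_Ico_eq_sub _ (by omega : j + 1 ≤ j + n + 1), Finset.sum_Ico_eq_sum_range,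
    show j + n + 1 - (j + 1) = n by omega, ← Finset.sum_range_reflect (fun i => ρ (j + n - i)) n]
  refine Finset.sum_congr rfl fun i hi => ?_
  have hi' := Finset.mem_range.mp hi
  rw [show j + n - (n - 1 - i) = j + 1 + i by omega]

/-- **THE SOURCE AT ONE POSITION FROM ABOVE.**  On a box run `g` of `K + n` steps of the family (`b > 0`, `ρ ≥ 0`), at `j < K`:
`Σ_{i<n} ρ(j+n−i)·(g_{j+n} − g_i) ≤ (R(j+n+1) − R(j+1))∕√(b(K−j))` — each gap is at most the coupling `g_{j+n} ≤ 1∕√(b(K−j))`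
(`…Source.coupling_le_inv_sqrt`). [cite: Balaban1987RG1, (0.31) p.259] -/
theorem extra_le_tail
    (hβ : ∀ (k : ℕ) (p : Fin (k + 1) → ℝ),
      β k p = b + ∑ i : Fin (k + 1), ρ (k - i) * min (p (Fin.last k)) (|p (Fin.last k) - p i|))
    (hb : 0 < b) (hρ0 : ∀ a, 0 ≤ ρ a) {K n : ℕ} {g : ℕ → ℝ} (h : RGEqH (K + n) β g)
    (hbox : ∀ k, k ≤ K + n → 0 < g k ∧ g k ≤ γ) {j : ℕ} (hj : j < K) :
    ∑ i ∈ range n, ρ (j + n - i) * (g (j + n) - g i)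
      ≤ (∑ a ∈ range (j + n + 1), ρ a - ∑ a ∈ range (j + 1), ρ a) * (1 / Real.sqrt (b * ((K - j : ℕ) : ℝ))) := by
  have hy := coupling_le_inv_sqrt hβ hb hρ0 h hbox hj
  rw [← sum_extra_eq_window ρ j n, Finset.sum_mul]
  refine Finset.sum_le_sum fun i hi => mul_le_mul_of_nonneg_left ?_ (hρ0 _)
  have hi' := Finset.mem_range.mp hi
  have hgi := (hbox i (by omega)).1
  linarith

/-- **THE SOURCE AT ONE POSITION FROM BELOW (infrared half).**  Same run with `Σ_{a<N} ρ(a) ≤ W`, `γ > 0`; at a position `j < K` with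
`2j + 1 ≥ K` every extra age `a ≥ j + 1` exceeds the infrared distance `K − j`, so `…Source.profile_min_le_gap` gives
`(R(j+n+1) − R(j+1))∕(8κ₂√(b₂(K−j))) ≤ Σ_{i<n} ρ(j+n−i)·(g_{j+n} − g_i)`, `b₂ = 1∕(g_{K+n})² + (b + Wγ)`, `κ₂ = b₂∕b`.
[cite: Balaban1987RG1, (0.31) p.259] -/
theorem tail_le_extra
    (hβ : ∀ (k : ℕ) (p : Fin (k + 1) → ℝ),
      β k p = b + ∑ i : Fin (k + 1), ρ (k - i) * min (p (Fin.last k)) (|p (Fin.last k) - p i|))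
    (hb : 0 < b) (hγ : 0 < γ) (hρ0 : ∀ a, 0 ≤ ρ a) (hρW : ∀ n, ∑ a ∈ range n, ρ a ≤ W) {K n : ℕ} {g : ℕ → ℝ}
    (h : RGEqH (K + n) β g) (hbox : ∀ k, k ≤ K + n → 0 < g k ∧ g k ≤ γ) {j : ℕ} (hj : j < K) (hIR : K ≤ 2 * j + 1) :
    (∑ a ∈ range (j + n + 1), ρ a - ∑ a ∈ range (j + 1), ρ a)
        * (1 / (8 * ((1 / (g (K + n)) ^ 2 + (b + W * γ)) / b)
            * Real.sqrt ((1 / (g (K + n)) ^ 2 + (b + W * γ)) * ((K - j : ℕ) : ℝ))))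
      ≤ ∑ i ∈ range n, ρ (j + n - i) * (g (j + n) - g i) := by
  have hW : 0 ≤ W := by simpa using hρW 0
  have hpinpos := (hbox (K + n) le_rfl).1
  set b₂ : ℝ := 1 / (g (K + n)) ^ 2 + (b + W * γ) with hb₂
  have hA0 : 0 ≤ 1 / (g (K + n)) ^ 2 := by positivity
  have hb₂b : b ≤ b₂ := by rw [hb₂]; nlinarith
  have hb₂pos : 0 < b₂ := lt_of_lt_of_le hb hb₂b
  have hκ₂ : 1 ≤ b₂ / b := by rwa [le_div_iff₀ hb, one_mul]
  have hs0 : (0 : ℝ) < ((K - j : ℕ) : ℝ) := by exact_mod_cast (show 0 < K - j by omega)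
  have hsq0 : 0 < Real.sqrt (b₂ * ((K - j : ℕ) : ℝ)) := Real.sqrt_pos.2 (by positivity)
  rw [← sum_extra_eq_window ρ j n, Finset.sum_mul]
  refine Finset.sum_le_sum fun i hi => mul_le_mul_of_nonneg_left ?_ (hρ0 _)
  have hi' := Finset.mem_range.mp hi
  -- the extra age `a = j + n − i ≥ j + 1 ≥ K − j`
  have hgap := profile_min_le_gap hβ hb hγ hρ0 hρW h hbox hj (show j + n - i ≤ j + n by omega)
  rw [show j + n - (j + n - i) = i by omega] at hgap
  refine le_trans ?_ hgap
  have hmin : 1 / (b₂ / b) ≤ min 1 (((j + n - i : ℕ) : ℝ) / (b₂ / b * ((K - j : ℕ) : ℝ))) := by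
    refine le_min ?_ ?_
    · rw [div_le_one (by positivity)]; exact hκ₂
    · rw [div_le_div_iff₀ (by positivity) (by positivity), one_mul]
      have ha : ((K - j : ℕ) : ℝ) ≤ ((j + n - i : ℕ) : ℝ) := by exact_mod_cast (show K - j ≤ j + n - i by omega)
      have := mul_le_mul_of_nonneg_left ha (by positivity : (0 : ℝ) ≤ b₂ / b)
      linarith
  have hpos : 0 ≤ 1 / (8 * Real.sqrt (b₂ * ((K - j : ℕ) : ℝ))) := by positivity
  calc 1 / (8 * (b₂ / b) * Real.sqrt (b₂ * ((K - j : ℕ) : ℝ)))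
      = 1 / (8 * Real.sqrt (b₂ * ((K - j : ℕ) : ℝ))) * (1 / (b₂ / b)) := by
        field_simp
    _ ≤ 1 / (8 * Real.sqrt (b₂ * ((K - j : ℕ) : ℝ))) * min 1 (((j + n - i : ℕ) : ℝ) / (b₂ / b * ((K - j : ℕ) : ℝ))) :=
        mul_le_mul_of_nonneg_left hmin hpos

/-- THE WINDOW SOURCE FROM ABOVE: `Σ_{j∈[j₀,K)} E_j ≤ (1∕√b)·Σ_{j∈[j₀,K)} (R(j+n+1) − R(j+1))∕√(K−j)`. [cite: Balaban1987RG1, (0.31) p.259] -/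
theorem sum_extra_le_tailWindow
    (hβ : ∀ (k : ℕ) (p : Fin (k + 1) → ℝ),
      β k p = b + ∑ i : Fin (k + 1), ρ (k - i) * min (p (Fin.last k)) (|p (Fin.last k) - p i|))
    (hb : 0 < b) (hρ0 : ∀ a, 0 ≤ ρ a) {K n : ℕ} {g : ℕ → ℝ} (h : RGEqH (K + n) β g)
    (hbox : ∀ k, k ≤ K + n → 0 < g k ∧ g k ≤ γ) {j₀ : ℕ} :
    ∑ j ∈ Ico j₀ K, ∑ i ∈ range n, ρ (j + n - i) * (g (j + n) - g i)
      ≤ 1 / Real.sqrt b * ∑ j ∈ Ico j₀ K,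
          (∑ a ∈ range (j + n + 1), ρ a - ∑ a ∈ range (j + 1), ρ a) / Real.sqrt ((K - j : ℕ) : ℝ) := by
  rw [Finset.mul_sum]
  refine Finset.sum_le_sum fun j hj => ?_
  have hj' := (Finset.mem_Ico.mp hj).2
  refine (extra_le_tail hβ hb hρ0 h hbox hj').trans (le_of_eq ?_)
  have hs0 : (0 : ℝ) < ((K - j : ℕ) : ℝ) := by exact_mod_cast (show 0 < K - j by omega)
  rw [Real.sqrt_mul hb.le]
  field_simp

/-- THE WINDOW SOURCE FROM BELOW (infrared half `2j₀ + 1 ≥ K`):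
`(1∕(8κ₂√b₂))·Σ_{j∈[j₀,K)} (R(j+n+1) − R(j+1))∕√(K−j) ≤ Σ_{j∈[j₀,K)} E_j`. [cite: Balaban1987RG1, (0.31) p.259] -/
theorem tailWindow_le_sum_extra
    (hβ : ∀ (k : ℕ) (p : Fin (k + 1) → ℝ),
      β k p = b + ∑ i : Fin (k + 1), ρ (k - i) * min (p (Fin.last k)) (|p (Fin.last k) - p i|))
    (hb : 0 < b) (hγ : 0 < γ) (hρ0 : ∀ a, 0 ≤ ρ a) (hρW : ∀ n, ∑ a ∈ range n, ρ a ≤ W) {K n : ℕ} {g : ℕ → ℝ}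
    (h : RGEqH (K + n) β g) (hbox : ∀ k, k ≤ K + n → 0 < g k ∧ g k ≤ γ) {j₀ : ℕ} (hIR : K ≤ 2 * j₀ + 1) :
    1 / (8 * ((1 / (g (K + n)) ^ 2 + (b + W * γ)) / b) * Real.sqrt (1 / (g (K + n)) ^ 2 + (b + W * γ)))
        * ∑ j ∈ Ico j₀ K, (∑ a ∈ range (j + n + 1), ρ a - ∑ a ∈ range (j + 1), ρ a) / Real.sqrt ((K - j : ℕ) : ℝ)
      ≤ ∑ j ∈ Ico j₀ K, ∑ i ∈ range n, ρ (j + n - i) * (g (j + n) - g i) := by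
  have hW : 0 ≤ W := by simpa using hρW 0
  have hpinpos := (hbox (K + n) le_rfl).1
  rw [Finset.mul_sum]
  refine Finset.sum_le_sum fun j hj => ?_
  have hj' := Finset.mem_Ico.mp hj
  refine le_trans (le_of_eq ?_) (tail_le_extra hβ hb hγ hρ0 hρW h hbox hj'.2 (by omega))
  set b₂ : ℝ := 1 / (g (K + n)) ^ 2 + (b + W * γ) with hb₂
  have hb₂pos : 0 < b₂ := by rw [hb₂]; positivity
  have hs0 : (0 : ℝ) < ((K - j : ℕ) : ℝ) := by exact_mod_cast (show 0 < K - j by omega)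
  have hsb : 0 < Real.sqrt b₂ := Real.sqrt_pos.2 hb₂pos
  have hss : 0 < Real.sqrt ((K - j : ℕ) : ℝ) := Real.sqrt_pos.2 hs0
  rw [Real.sqrt_mul hb₂pos.le]
  field_simp

/-! ## §2 The two-sided window law modulo the ultraviolet feedback -/

/-- **WINDOW LAW, UPPER SIDE (infrared half).**  Two runs of the order-0 profile family in ]0,γ] (`b > 0`, `ρ ≥ 0`) — A: `K` steps, B: `K + n`
steps — pinned `g^A_K = g^B_{K+n}`, and a position `j₀ ≤ K` with `2j₀ + 1 ≥ K`.  THEN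
`1∕(g^B_{j₀+n})² − 1∕(g^A_{j₀})² ≤ (1∕√b)·𝒯 + Σ_{i<j₀} ((g^A_i)³∕2)·d_i·(R(K−i) − R(j₀−i))`,
`𝒯 = Σ_{j∈[j₀,K)} (R(j+n+1) − R(j+1))∕√(K−j)` (the window's missing ages over the root of the infrared distance), `d_i = 1∕(g^B_{i+n})² − 1∕(g^A_i)²`
the discrepancies at the ULTRAVIOLET positions, entering through the cube of their couplings (`…Weights.gap_le_cube_mul`).
[cite: Balaban1987RG1, (0.20) p.256, (0.31) and Thm 2 p.259] -/
theorem window_law_upper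
    (hβ : ∀ (k : ℕ) (p : Fin (k + 1) → ℝ),
      β k p = b + ∑ i : Fin (k + 1), ρ (k - i) * min (p (Fin.last k)) (|p (Fin.last k) - p i|))
    (hb : 0 < b) (hρ0 : ∀ a, 0 ≤ ρ a) {K n : ℕ} {gA gB : ℕ → ℝ} (hA : RGEqH K β gA) (hB : RGEqH (K + n) β gB)
    (hApos : ∀ k, k ≤ K → 0 < gA k) (hBbox : ∀ k, k ≤ K + n → 0 < gB k ∧ gB k ≤ γ) (hpin : gA K = gB (K + n)) {j₀ : ℕ}
    (hj₀ : j₀ ≤ K) (hIR : K ≤ 2 * j₀ + 1) :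
    1 / (gB (j₀ + n)) ^ 2 - 1 / (gA j₀) ^ 2
      ≤ 1 / Real.sqrt b * (∑ j ∈ Ico j₀ K, (∑ a ∈ range (j + n + 1), ρ a - ∑ a ∈ range (j + 1), ρ a) / Real.sqrt ((K - j : ℕ) : ℝ))
        + ∑ i ∈ range j₀, (gA i) ^ 3 / 2 * (1 / (gB (i + n)) ^ 2 - 1 / (gA i) ^ 2)
            * (∑ a ∈ range (K - i), ρ a - ∑ a ∈ range (j₀ - i), ρ a) := by
  have hBpos : ∀ k, k ≤ K + n → 0 < gB k := fun k hk => (hBbox k hk).1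
  have h1 := window_upper hβ hb hρ0 hA hB hApos hBpos hpin hj₀ hIR
  have h2 := sum_extra_le_tailWindow hβ hb hρ0 hB hBbox (j₀ := j₀)
  have hdom := invSq_le_invSq_shift_run hβ hb hρ0 hA hB hApos hBpos hpin
  have h3 : ∑ i ∈ range j₀, (gA i - gB (i + n)) * (∑ a ∈ range (K - i), ρ a - ∑ a ∈ range (j₀ - i), ρ a)
      ≤ ∑ i ∈ range j₀, (gA i) ^ 3 / 2 * (1 / (gB (i + n)) ^ 2 - 1 / (gA i) ^ 2)
          * (∑ a ∈ range (K - i), ρ a - ∑ a ∈ range (j₀ - i), ρ a) := by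
    refine Finset.sum_le_sum fun i hi => ?_
    have hi' : i ≤ K := by have := Finset.mem_range.mp hi; omega
    have hR : 0 ≤ ∑ a ∈ range (K - i), ρ a - ∑ a ∈ range (j₀ - i), ρ a := by
      linarith [partialSum_mono hρ0 (show j₀ - i ≤ K - i by omega)]
    exact mul_le_mul_of_nonneg_right (gap_le_cube_mul (hBpos (i + n) (by omega))
      (le_of_one_div_sq_le (hApos i hi') (hBpos (i + n) (by omega)) (hdom i hi'))) hR
  linarith

/-- **WINDOW LAW, LOWER SIDE (infrared half, no smallness).**  Same two pinned runs with `Σ_{a<N} ρ(a) ≤ W`, a position `j₀ ≤ K` with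
`2j₀ + 1 ≥ K`, and any bound `P` of the discrepancies `d_i` on `[j₀, K]`.  THEN `𝒯∕(8κ₂√b₂) ≤ d_{j₀} + (Wγ∕b)·P`
(`b₂ = 1∕(g^B_{K+n})² + b + Wγ`, `κ₂ = b₂∕b`); in particular, with `P` the window maximum, SOME position `j ∈ [j₀, K]` has
`𝒯 ≤ 8κ₂√b₂·(1 + Wγ∕b)·d_j`. [cite: Balaban1987RG1, (0.20) p.256, (0.31) and Thm 2 p.259] -/
theorem window_law_lower
    (hβ : ∀ (k : ℕ) (p : Fin (k + 1) → ℝ),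
      β k p = b + ∑ i : Fin (k + 1), ρ (k - i) * min (p (Fin.last k)) (|p (Fin.last k) - p i|))
    (hb : 0 < b) (hγ : 0 < γ) (hρ0 : ∀ a, 0 ≤ ρ a) (hρW : ∀ n, ∑ a ∈ range n, ρ a ≤ W) {K n : ℕ} {gA gB : ℕ → ℝ}
    (hA : RGEqH K β gA) (hB : RGEqH (K + n) β gB) (hAbox : ∀ k, k ≤ K → 0 < gA k ∧ gA k ≤ γ)
    (hBbox : ∀ k, k ≤ K + n → 0 < gB k ∧ gB k ≤ γ) (hpin : gA K = gB (K + n)) {j₀ : ℕ} (hj₀ : j₀ ≤ K)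
    (hIR : K ≤ 2 * j₀ + 1) :
    (∀ P : ℝ, (∀ i, j₀ ≤ i → i ≤ K → 1 / (gB (i + n)) ^ 2 - 1 / (gA i) ^ 2 ≤ P) →
      1 / (8 * ((1 / (gB (K + n)) ^ 2 + (b + W * γ)) / b) * Real.sqrt (1 / (gB (K + n)) ^ 2 + (b + W * γ)))
          * ∑ j ∈ Ico j₀ K, (∑ a ∈ range (j + n + 1), ρ a - ∑ a ∈ range (j + 1), ρ a) / Real.sqrt ((K - j : ℕ) : ℝ)
        ≤ (1 / (gB (j₀ + n)) ^ 2 - 1 / (gA j₀) ^ 2) + W * γ / b * P)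
    ∧ ∃ j, j₀ ≤ j ∧ j ≤ K ∧
      ∑ j ∈ Ico j₀ K, (∑ a ∈ range (j + n + 1), ρ a - ∑ a ∈ range (j + 1), ρ a) / Real.sqrt ((K - j : ℕ) : ℝ)
        ≤ 8 * ((1 / (gB (K + n)) ^ 2 + (b + W * γ)) / b) * Real.sqrt (1 / (gB (K + n)) ^ 2 + (b + W * γ))
          * (1 + W * γ / b) * (1 / (gB (j + n)) ^ 2 - 1 / (gA j) ^ 2) := by
  classical
  have hApos : ∀ k, k ≤ K → 0 < gA k := fun k hk => (hAbox k hk).1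
  have hBpos : ∀ k, k ≤ K + n → 0 < gB k := fun k hk => (hBbox k hk).1
  have hW : 0 ≤ W := by simpa using hρW 0
  have hlow := tailWindow_le_sum_extra hβ hb hγ hρ0 hρW hB hBbox (j₀ := j₀) hIR
  have hPform : ∀ P : ℝ, (∀ i, j₀ ≤ i → i ≤ K → 1 / (gB (i + n)) ^ 2 - 1 / (gA i) ^ 2 ≤ P) →
      1 / (8 * ((1 / (gB (K + n)) ^ 2 + (b + W * γ)) / b) * Real.sqrt (1 / (gB (K + n)) ^ 2 + (b + W * γ)))
          * ∑ j ∈ Ico j₀ K, (∑ a ∈ range (j + n + 1), ρ a - ∑ a ∈ range (j + 1), ρ a) / Real.sqrt ((K - j : ℕ) : ℝ)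
        ≤ (1 / (gB (j₀ + n)) ^ 2 - 1 / (gA j₀) ^ 2) + W * γ / b * P :=
    fun P hP => hlow.trans (window_lower_max hβ hb hγ hρ0 hρW hA hB hAbox hBbox hpin hj₀ hP)
  refine ⟨hPform, ?_⟩
  -- the window maximum
  set d : ℕ → ℝ := fun j => 1 / (gB (j + n)) ^ 2 - 1 / (gA j) ^ 2 with hd
  obtain ⟨j₁, hj₁, hmax₁⟩ := Finset.exists_max_image (Icc j₀ K) d ⟨j₀, Finset.mem_Icc.mpr ⟨le_rfl, hj₀⟩⟩
  have hj₁' := Finset.mem_Icc.mp hj₁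
  refine ⟨j₁, hj₁'.1, hj₁'.2, ?_⟩
  have hP := hPform (d j₁) fun i hi1 hi2 => hmax₁ i (Finset.mem_Icc.mpr ⟨hi1, hi2⟩)
  have hdj₀ : d j₀ ≤ d j₁ := hmax₁ j₀ (Finset.mem_Icc.mpr ⟨le_rfl, hj₀⟩)
  have hpinpos := hBpos (K + n) le_rfl
  set b₂ : ℝ := 1 / (gB (K + n)) ^ 2 + (b + W * γ) with hb₂
  have hb₂pos : 0 < b₂ := by rw [hb₂]; positivity
  have hc : 0 < 8 * (b₂ / b) * Real.sqrt b₂ := by positivity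
  set T : ℝ := ∑ j ∈ Ico j₀ K, (∑ a ∈ range (j + n + 1), ρ a - ∑ a ∈ range (j + 1), ρ a) / Real.sqrt ((K - j : ℕ) : ℝ) with hT
  have h1 : 1 / (8 * (b₂ / b) * Real.sqrt b₂) * T ≤ (1 + W * γ / b) * d j₁ := by
    have : d j₀ + W * γ / b * d j₁ ≤ (1 + W * γ / b) * d j₁ := by nlinarith
    exact hP.trans this
  have h2 : T ≤ 8 * (b₂ / b) * Real.sqrt b₂ * ((1 + W * γ / b) * d j₁) := by
    rw [← div_le_iff₀' hc]
    simpa [one_div, div_eq_inv_mul] using h1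
  calc T ≤ 8 * (b₂ / b) * Real.sqrt b₂ * ((1 + W * γ / b) * d j₁) := h2
    _ = 8 * (b₂ / b) * Real.sqrt b₂ * (1 + W * γ / b) * d j₁ := by ring

end Summit.QuantumFields.BalabanUV.Beta.RemainderExplicitHistoryDiagonalWindowSource

end
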